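import Literature.Topology.FourManifolds.GenusThreePrimitiveOrReducing
import HarnessLib

/-!
# `Trisection.MeetsOnceTransv`: first API (symmetry, the intersection point)

Topic `Literature/Topology/FourManifolds`; the `…Proofs` sibling of
`GenusThreePrimitiveOrReducing.lean` (the predicate `Trisection.MeetsOnceTransv c c'`: two curves
of a smooth `4`-manifold meet in exactly one point, at which smooth parametrisations have tangent
lines meeting only in `0`).  Everything here is proved; no definition, no named fact:

* `Trisection.MeetsOnceTransv.symm`, `Trisection.meetsOnceTransv_comm` — the predicate is
  symmetric (the tangent-line condition "`Dγ v = Dγ' w ⟹ Dγ v = 0`" is equivalent to its mirror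
  image, both saying that the two lines meet only in `0`);
* `Trisection.MeetsOnceTransv.exists_inter_eq_singleton`, `….inter_nonempty`,
  `….subsingleton_inter` — the set-level content.

References: R. Aranda, A. Zupan, arXiv:2503.04607 (2025), §2 (p. 3: "`|c ∩ c′| = 1`").
-/

noncomputable section

open scoped Manifold ContDiff Topology
open Set

namespace Literature.Topology.FourManifolds

namespace Trisection

universe u

variable {X : Type u} [TopologicalSpace X] [ChartedSpace (EuclideanSpace ℝ (Fin 4)) X]

/-- `MeetsOnceTransv` is symmetric: swap the two curves, their parametrisations and parameters;
the tangent-line condition is symmetric because "`Dγ v = Dγ' w ⟹ Dγ v = 0`" forces the common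
vector, hence also `Dγ' w`, to vanish. [folklore] -/
theorem MeetsOnceTransv.symm {c c' : Set X} (h : MeetsOnceTransv c c') : MeetsOnceTransv c' c := by
  obtain ⟨x, hx, γ, γ', s, s', hγ, hrγ, hγ', hrγ', hs, hs', htan⟩ := h
  refine ⟨x, by rw [inter_comm, hx], γ', γ, s', s, hγ', hrγ', hγ, hrγ, hs', hs, fun w v hwv => ?_⟩
  have h0 : (mfderiv (𝓡 1) (𝓡 4) γ s v : EuclideanSpace ℝ (Fin 4)) = 0 := htan v w hwv.symm
  exact hwv.trans h0

/-- `MeetsOnceTransv c c' ↔ MeetsOnceTransv c' c`. [folklore] -/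
theorem meetsOnceTransv_comm {c c' : Set X} : MeetsOnceTransv c c' ↔ MeetsOnceTransv c' c :=
  ⟨MeetsOnceTransv.symm, MeetsOnceTransv.symm⟩

/-- Two curves meeting once transversally meet in exactly one point (the set-level content).
[folklore] -/
theorem MeetsOnceTransv.exists_inter_eq_singleton {c c' : Set X} (h : MeetsOnceTransv c c') :
    ∃ x : X, c ∩ c' = {x} := by
  obtain ⟨x, hx, -⟩ := h
  exact ⟨x, hx⟩

/-- Two curves meeting once transversally do meet. [folklore] -/
theorem MeetsOnceTransv.inter_nonempty {c c' : Set X} (h : MeetsOnceTransv c c') :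
    (c ∩ c').Nonempty := by
  obtain ⟨x, hx⟩ := h.exists_inter_eq_singleton
  exact ⟨x, by rw [hx]; exact mem_singleton x⟩

/-- Two curves meeting once transversally meet in at most one point. [folklore] -/
theorem MeetsOnceTransv.subsingleton_inter {c c' : Set X} (h : MeetsOnceTransv c c') :
    (c ∩ c').Subsingleton := by
  obtain ⟨x, hx⟩ := h.exists_inter_eq_singleton
  rw [hx]
  exact subsingleton_singleton

/-- In particular two curves meeting once transversally are not disjoint. [folklore] -/
theorem MeetsOnceTransv.not_disjoint {c c' : Set X} (h : MeetsOnceTransv c c') :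
    ¬ Disjoint c c' := fun hd =>
  h.inter_nonempty.ne_empty (disjoint_iff_inter_eq_empty.mp hd)

end Trisection

end Literature.Topology.FourManifolds

end
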